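import Summits.BirchSwinnertonDyer.BirchSwinnertonDyer.Theorems.BiquadraticEisensteinDescentManinDatumSupercuspidalCMInertCoreOfResolventBoundJZero
import Literature.NumberTheory.EllipticCurves.EisensteinLatticeCMThree
import HarnessLib

set_option linter.dupNamespace false -- `Summit.BirchSwinnertonDyer.BirchSwinnertonDyer.Theorems.…` (summit = sub, D-0017)
set_option autoImplicit false

/-!
# Crux `ManinDatumSupercuspidalCMInert` (stmt-BirchSwinnertonDyer-20111, BED r605), stub `stub_S5` (`j = 0` at `p = 5`) — RANGE REDUCTION of
# the resolvent bound RES₅: `R_n^{(k)} = 0` unless `n ≡ k (mod 3)`, and the bound is termwise for `n ≥ 2(6 − k)`; so RES₅ reduces to the SEVEN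
# pairs `(k, n) ∈ {(1,1), (1,4), (1,7), (2,2), (2,5), (3,3), (4,1)}`

Route `BiquadraticEisensteinDescent` (cell `pub/bsd-wall`, width seat `bsd-wall-cm-bed-w1` g8; `--supports` stmt-BirchSwinnertonDyer-20111,
helper). THEOREMS ONLY (no definition, no named fact, no `sorry`); nothing is closed by this file and BSD is not proved by any of it.

The `ℤρ + ℤ` / `p = 5` twin of bed-w2 g10's `…ResolventBoundReduction` (`j = 1728`, `p = 7`: odd `n` vanish, `n ≥ 6(4 − k)` termwise), for an
ABSTRACT weight `Φ : (ℤ/5)² → ℂ` (coordinates `d ↔ c = d₁ρ + d₂ ∈ ℤ[ρ]/5`, `t_d = (d₁ρ + d₂)/5`) with `Φ 0 = 0` and the `ρ`-EQUIVARIANCE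
`Φ(ρ·d) = ρ^k·Φ(d)`, `ρ·d := (d₂ − d₁, −d₁)` (the coordinates of `ρ(d₁ρ + d₂)`; for the sextic character `Φ = (·/5)₆^k` this is `(ρ/5)₆ = ρ⁴ = ρ`):

* `divPointRho_rhoMul_sub_mem`, `inv_normalizedX_divPointRho_rhoMul` — `t_{ρ·d} ≡ ρ·t_d (mod Λ)`, hence `π_{ρ·d} = ρ²·π_d`
  (`℘(ρz) = ρ℘(z)`, Literature `EisensteinLattice.weierstrassP_rho_mul`, `EisensteinLatticeCMThree`);
* `rho_pow_eq_one_iff` — `ρ^m = 1 ↔ 3 ∣ m`;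
* ★ `resolventSum_rho_eq_zero_of_not_dvd` — **`R_n^{(k)} := Σ_d Φ(d)·π_dⁿ = 0` whenever `3 ∤ k + 2n`** (i.e. `n ≢ k (mod 3)`): re-indexing by the
  bijection `d ↦ ρ·d` multiplies the sum by `ρ^{k+2n}`;
* ★ `val_resolventSum_rho_pow_six_le_of_le` — **termwise bound for `n ≥ 2(6 − k)`**: `v(R_n^{(k)})⁶ ≤ v(5)^{6−k}` at every valuation `v` of `ℂ` with
  `v 5 < 1`, for `v Φ ≤ 1` (`v(π_d)¹² = v 5`, p641325);
* ★ `resolventBound_rho_of_small` — **RES₅fin ⟹ RES₅**, RES₅fin := the bound for `1 ≤ n < 2(6 − k)` with `3 ∣ k + 2n` only (for `k ∈ {1,…,5}`: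
  the seven pairs above; kit j311001 gives their exact power-basis expansions, memo `Cruxes/…/KIT-RES-CERT-w1g8.md`);
* ★ `core_rho_of_smallResolventBound` — RES₅fin ⟹ the abstract-weight core of `…CoreOfResolventBoundJZero.core_rho_of_resolventBound`.

HONEST FRAMING: RES₅fin is NOT proved here; nothing here proves the stub, the crux, Manin's conjecture or BSD.
-/

noncomputable section

open scoped Classical
open Complex PeriodPair
open Literature.NumberTheory.EllipticCurves

namespace Summit.BirchSwinnertonDyer.BirchSwinnertonDyer.Theorems.BiquadraticEisensteinDescentManinDatumSupercuspidalCMInertResolventBoundReductionJZero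

open Summit.BirchSwinnertonDyer.BirchSwinnertonDyer.Theorems.BiquadraticEisensteinDescentManinDatumSupercuspidalCMInertTorsionCoreOfResolventBound
  (val_sum_pow_le)
open Summit.BirchSwinnertonDyer.BirchSwinnertonDyer.Theorems.BiquadraticEisensteinDescentManinDatumSupercuspidalCMInertFiveDivisionEisensteinJZero
  (val_weierstrassP_five_div_rho)
open Summit.BirchSwinnertonDyer.BirchSwinnertonDyer.Theorems.BiquadraticEisensteinDescentManinDatumSupercuspidalCMInertTorsionCoordinatesJZero
  (five_mul_divPointRho_mem divPointRho_notMem)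
open Summit.BirchSwinnertonDyer.BirchSwinnertonDyer.Theorems.BiquadraticEisensteinDescentManinDatumSupercuspidalCMInertCoreOfResolventBoundJZero
  (core_rho_of_resolventBound)

/-! ## §1 `ρ` acting on the `5`-division points -/

/-- **`t_{ρ·d} ≡ ρ·t_d (mod Λ)`** for `ρ·d = (d₂ − d₁, −d₁)`: `ρ(d₁ρ + d₂) = (d₂ − d₁)ρ − d₁`, and the representatives agree modulo `5`.
[folklore] -/
theorem divPointRho_rhoMul_sub_mem (d : ZMod 5 × ZMod 5) :
    (((d.2 - d.1).val : ℂ) * UpperHalfPlane.ρ + ((-d.1).val : ℂ)) / 5 -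
        (UpperHalfPlane.ρ : ℂ) * (((d.1.val : ℂ) * UpperHalfPlane.ρ + (d.2.val : ℂ)) / 5) ∈
      (ofUpperHalfPlane UpperHalfPlane.ρ).lattice := by
  have key1 : ∀ x y : ZMod 5, ∃ e : ℤ, ((x - y).val : ℤ) - x.val + y.val = 5 * e := by
    intro x y; fin_cases x <;> fin_cases y <;> first | exact ⟨0, by decide⟩ | exact ⟨1, by decide⟩
  have key2 : ∀ x : ZMod 5, ∃ e : ℤ, (((-x).val : ℤ) + x.val) = 5 * e := by
    intro x; fin_cases x <;> first | exact ⟨0, by decide⟩ | exact ⟨1, by decide⟩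
  obtain ⟨e1, he1⟩ := key1 d.2 d.1
  obtain ⟨e2, he2⟩ := key2 d.1
  rw [EisensteinLattice.mem_lattice_iff]
  refine ⟨e1, e2, ?_⟩
  have h1 : (((d.2 - d.1).val : ℂ)) - (d.2.val : ℂ) + (d.1.val : ℂ) = 5 * (e1 : ℂ) := by exact_mod_cast he1
  have h2 : (((-d.1).val : ℂ)) + (d.1.val : ℂ) = 5 * (e2 : ℂ) := by exact_mod_cast he2
  linear_combination (-(UpperHalfPlane.ρ : ℂ) / 5) * h1 + (-1 / 5 : ℂ) * h2 + ((d.1.val : ℂ) / 5) * UpperHalfPlane.ρ_sq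

/-- **`π_{ρ·d} = ρ²·π_d`**: `X(t_{ρ·d}) = X(ρt_d) = ρX(t_d)`, so `X(t_{ρ·d})⁻¹ = ρ⁻¹X(t_d)⁻¹ = ρ²X(t_d)⁻¹` (any `ϖ`). [folklore] -/
theorem inv_normalizedX_divPointRho_rhoMul (d : ZMod 5 × ZMod 5) (ϖ : ℂ) :
    (℘[ofUpperHalfPlane UpperHalfPlane.ρ] ((((d.2 - d.1).val : ℂ) * UpperHalfPlane.ρ + ((-d.1).val : ℂ)) / 5) / ϖ ^ 2)⁻¹ =
      (UpperHalfPlane.ρ : ℂ) ^ 2 * (℘[ofUpperHalfPlane UpperHalfPlane.ρ] (((d.1.val : ℂ) * UpperHalfPlane.ρ + (d.2.val : ℂ)) / 5) / ϖ ^ 2)⁻¹ := by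
  set u : ℂ := (((d.2 - d.1).val : ℂ) * UpperHalfPlane.ρ + ((-d.1).val : ℂ)) / 5 with hu
  set t : ℂ := (((d.1.val : ℂ) * UpperHalfPlane.ρ + (d.2.val : ℂ)) / 5) with ht
  have hmem := divPointRho_rhoMul_sub_mem d
  have hX : ℘[ofUpperHalfPlane UpperHalfPlane.ρ] u = (UpperHalfPlane.ρ : ℂ) * ℘[ofUpperHalfPlane UpperHalfPlane.ρ] t := by
    have e : u = (UpperHalfPlane.ρ : ℂ) * t + (u - (UpperHalfPlane.ρ : ℂ) * t) := by ring
    rw [e, (ofUpperHalfPlane UpperHalfPlane.ρ).weierstrassP_add_coe _ ⟨_, hmem⟩, EisensteinLattice.weierstrassP_rho_mul]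
  have h3 : (UpperHalfPlane.ρ : ℂ) ^ 3 = 1 := ρ_cube
  have hρ0 : (UpperHalfPlane.ρ : ℂ) ≠ 0 := ρ_ne_zero
  rw [hX, mul_div_assoc, mul_inv, inv_eq_of_mul_eq_one_left (show (UpperHalfPlane.ρ : ℂ) ^ 2 * UpperHalfPlane.ρ = 1 by
    rw [← pow_succ]; exact h3)]

/-- `ρ^m = 1 ↔ 3 ∣ m`. [folklore] -/
theorem rho_pow_eq_one_iff (m : ℕ) : (UpperHalfPlane.ρ : ℂ) ^ m = 1 ↔ 3 ∣ m := by
  have h3 : (UpperHalfPlane.ρ : ℂ) ^ 3 = 1 := ρ_cube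
  have hρ2 : (UpperHalfPlane.ρ : ℂ) ^ 2 ≠ 1 := by
    intro h
    rw [UpperHalfPlane.ρ_sq] at h
    have : (UpperHalfPlane.ρ : ℂ) = -2 := by linear_combination (-1 : ℂ) * h
    have him := congrArg Complex.im this
    rw [UpperHalfPlane.coe_im] at him
    norm_num at him
    exact UpperHalfPlane.ρ.im_pos.ne' him
  constructor
  · intro h
    have hm : m = 3 * (m / 3) + m % 3 := (Nat.div_add_mod m 3).symm
    rw [hm, pow_add, pow_mul, h3, one_pow, one_mul] at h
    have hr : m % 3 < 3 := Nat.mod_lt _ (by norm_num)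
    interval_cases hr' : m % 3
    · omega
    · rw [pow_one] at h; exact absurd h ρ_ne_one
    · exact absurd h hρ2
  · rintro ⟨q, rfl⟩
    rw [pow_mul, h3, one_pow]

/-! ## §2 `R_n^{(k)} = 0` unless `n ≡ k (mod 3)` -/

/-- ★ **`R_n^{(k)} = 0` for `3 ∤ k + 2n`.** For `Φ` with `Φ(ρ·d) = ρ^k Φ(d)`: re-indexing `Σ_d Φ(d)π_dⁿ` by the bijection `d ↦ ρ·d` of
`(ℤ/5)²` multiplies every term by `ρ^k·(ρ²)ⁿ`, so `(1 − ρ^{k+2n})·R_n = 0`. [cite: IrelandRosen1982, Ch. 9 §3 (characters on `ℤ[ω]/π`)] -/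
theorem resolventSum_rho_eq_zero_of_not_dvd {k : ℕ} (Φ : ZMod 5 × ZMod 5 → ℂ)
    (hΦrho : ∀ d : ZMod 5 × ZMod 5, Φ (d.2 - d.1, -d.1) = (UpperHalfPlane.ρ : ℂ) ^ k * Φ d)
    {n : ℕ} (hn : ¬ 3 ∣ k + 2 * n) (ϖ : ℂ) :
    ∑ d : ZMod 5 × ZMod 5, Φ d *
      (℘[ofUpperHalfPlane UpperHalfPlane.ρ] (((d.1.val : ℂ) * UpperHalfPlane.ρ + (d.2.val : ℂ)) / 5) / ϖ ^ 2)⁻¹ ^ n = 0 := by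
  -- `d ↦ ρ·d` is a bijection
  have hτinj : Function.Injective (fun d : ZMod 5 × ZMod 5 ↦ ((d.2 - d.1, -d.1) : ZMod 5 × ZMod 5)) := by
    intro d d' h
    simp only [Prod.mk.injEq, neg_inj] at h
    obtain ⟨h1, h2⟩ := h
    refine Prod.ext h2 ?_
    have := h1; rw [h2] at this; simpa using this
  have hτbij : Function.Bijective (fun d : ZMod 5 × ZMod 5 ↦ ((d.2 - d.1, -d.1) : ZMod 5 × ZMod 5)) :=
    Finite.injective_iff_bijective.mp hτinj
  have key : ∀ d : ZMod 5 × ZMod 5,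
      Φ (d.2 - d.1, -d.1) * (℘[ofUpperHalfPlane UpperHalfPlane.ρ]
          (((((d.2 - d.1, -d.1) : ZMod 5 × ZMod 5).1.val : ℂ) * UpperHalfPlane.ρ + ((((d.2 - d.1, -d.1) : ZMod 5 × ZMod 5).2.val : ℂ))) / 5) / ϖ ^ 2)⁻¹ ^ n =
        (UpperHalfPlane.ρ : ℂ) ^ (k + 2 * n) *
          (Φ d * (℘[ofUpperHalfPlane UpperHalfPlane.ρ] (((d.1.val : ℂ) * UpperHalfPlane.ρ + (d.2.val : ℂ)) / 5) / ϖ ^ 2)⁻¹ ^ n) := by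
    intro d
    simp only
    rw [hΦrho d, inv_normalizedX_divPointRho_rhoMul d ϖ, mul_pow, ← pow_mul, pow_add]
    ring
  have hsum := Fintype.sum_bijective _ hτbij
    (fun d : ZMod 5 × ZMod 5 ↦ Φ (d.2 - d.1, -d.1) * (℘[ofUpperHalfPlane UpperHalfPlane.ρ]
          (((((d.2 - d.1, -d.1) : ZMod 5 × ZMod 5).1.val : ℂ) * UpperHalfPlane.ρ + ((((d.2 - d.1, -d.1) : ZMod 5 × ZMod 5).2.val : ℂ))) / 5) / ϖ ^ 2)⁻¹ ^ n)
    (fun d : ZMod 5 × ZMod 5 ↦ Φ d * (℘[ofUpperHalfPlane UpperHalfPlane.ρ] (((d.1.val : ℂ) * UpperHalfPlane.ρ + (d.2.val : ℂ)) / 5) / ϖ ^ 2)⁻¹ ^ n)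
    (fun _ ↦ rfl)
  simp only [key, ← Finset.mul_sum] at hsum
  -- hsum : ρ^(k+2n) * R = R
  have hne : (UpperHalfPlane.ρ : ℂ) ^ (k + 2 * n) ≠ 1 := fun h ↦ hn ((rho_pow_eq_one_iff _).mp h)
  have : ((UpperHalfPlane.ρ : ℂ) ^ (k + 2 * n) - 1) *
      ∑ d : ZMod 5 × ZMod 5, Φ d * (℘[ofUpperHalfPlane UpperHalfPlane.ρ] (((d.1.val : ℂ) * UpperHalfPlane.ρ + (d.2.val : ℂ)) / 5) / ϖ ^ 2)⁻¹ ^ n = 0 := by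
    linear_combination hsum
  rcases mul_eq_zero.mp this with h | h
  · exact absurd (sub_eq_zero.mp h) hne
  · exact h

/-! ## §3 Large exponents are trivial termwise -/

/-- ★ **Termwise bound for `n ≥ 2(6 − k)`.** For `Φ 0 = 0`, `v Φ ≤ 1`, `2(6 − k) ≤ n` and every valuation `v` of `ℂ` with `v 5 < 1`:
`v(R_n^{(k)})⁶ ≤ v(5)^{6−k}` — each summand has `v(Φ(d)π_dⁿ)⁶ ≤ v(π_d)^{6n} ≤ v(π_d)^{12(6−k)} = v(5)^{6−k}` (`v(π_d)¹² = v 5`).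
[cite: SilvermanAEC2009, Thm. V.3.1] [cite: Serre1979, Ch. I §6] -/
theorem val_resolventSum_rho_pow_six_le_of_le {k : ℕ} {n : ℕ} (hn : 2 * (6 - k) ≤ n)
    (Φ : ZMod 5 × ZMod 5 → ℂ) (hΦ0 : Φ 0 = 0)
    {Γ₀ : Type*} [LinearOrderedCommGroupWithZero Γ₀] (v : Valuation ℂ Γ₀) (hv : v 5 < 1) (hΦv : ∀ d, v (Φ d) ≤ 1) :
    v (∑ d : ZMod 5 × ZMod 5, Φ d *
      (℘[ofUpperHalfPlane UpperHalfPlane.ρ] (((d.1.val : ℂ) * UpperHalfPlane.ρ + (d.2.val : ℂ)) / 5) /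
        (((2 : ℝ) ^ (2 / 3 : ℝ) * Real.Gamma (1 / 3) ^ 3 / (4 * Real.pi) : ℝ) : ℂ) ^ 2)⁻¹ ^ n) ^ 6 ≤ v 5 ^ (6 - k) := by
  refine val_sum_pow_le v Finset.univ _ (by norm_num) fun d _ ↦ ?_
  by_cases hd : d = 0
  · subst hd
    rw [hΦ0, zero_mul, Valuation.map_zero, zero_pow (by norm_num)]
    exact zero_le
  · obtain ⟨-, -, hv12, -⟩ := val_weierstrassP_five_div_rho v hv (divPointRho_notMem hd) (five_mul_divPointRho_mem d)
    set π : ℂ := (℘[ofUpperHalfPlane UpperHalfPlane.ρ] (((d.1.val : ℂ) * UpperHalfPlane.ρ + (d.2.val : ℂ)) / 5) /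
        (((2 : ℝ) ^ (2 / 3 : ℝ) * Real.Gamma (1 / 3) ^ 3 / (4 * Real.pi) : ℝ) : ℂ) ^ 2)⁻¹ with hπ
    have hπ1 : v π ≤ 1 := by
      by_contra h
      push Not at h
      have h12 : 1 ≤ v π ^ 12 := one_le_pow_of_one_le' h.le 12
      rw [hv12] at h12
      exact absurd hv (not_lt.mpr h12)
    rw [Valuation.map_mul, mul_pow, Valuation.map_pow, ← pow_mul]
    have h1 : v (Φ d) ^ 6 ≤ 1 := pow_le_one₀ zero_le (hΦv d)
    have h2 : v π ^ (n * 6) ≤ v 5 ^ (6 - k) := by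
      rw [← hv12, ← pow_mul]
      exact pow_le_pow_right_of_le_one' hπ1 (by omega)
    calc v (Φ d) ^ 6 * v π ^ (n * 6) ≤ 1 * v 5 ^ (6 - k) := mul_le_mul' h1 h2
      _ = v 5 ^ (6 - k) := one_mul _

/-! ## §4 The reduction and the closer -/

/-- ★ **RES₅fin ⟹ RES₅.** If the resolvent bound `v(R_n^{(k)})⁶ ≤ v(5)^{6−k}` holds for the finitely many `n` with `1 ≤ n < 2(6 − k)` and `3 ∣ k + 2n`
(for `k ∈ {1,…,5}`: `(k,n) ∈ {(1,1),(1,4),(1,7),(2,2),(2,5),(3,3),(4,1)}`), then it holds for every `n ≥ 1` (`Φ 0 = 0`, `Φ(ρ·d) = ρ^kΦ(d)`,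
algebraic-integer values). [folklore] -/
theorem resolventBound_rho_of_small {k : ℕ} (Φ : ZMod 5 × ZMod 5 → ℂ) (hΦ0 : Φ 0 = 0)
    (hΦrho : ∀ d : ZMod 5 × ZMod 5, Φ (d.2 - d.1, -d.1) = (UpperHalfPlane.ρ : ℂ) ^ k * Φ d) (hΦint : ∀ d, IsIntegral ℤ (Φ d))
    (h : ∀ n : ℕ, 1 ≤ n → 3 ∣ k + 2 * n → n < 2 * (6 - k) →
      ∀ (Γ₀ : Type) [LinearOrderedCommGroupWithZero Γ₀] (v : Valuation ℂ Γ₀), v 5 < 1 →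
        v (∑ d : ZMod 5 × ZMod 5, Φ d *
          (℘[ofUpperHalfPlane UpperHalfPlane.ρ] (((d.1.val : ℂ) * UpperHalfPlane.ρ + (d.2.val : ℂ)) / 5) /
            (((2 : ℝ) ^ (2 / 3 : ℝ) * Real.Gamma (1 / 3) ^ 3 / (4 * Real.pi) : ℝ) : ℂ) ^ 2)⁻¹ ^ n) ^ 6 ≤ v 5 ^ (6 - k)) :
    ∀ n : ℕ, 1 ≤ n → ∀ (Γ₀ : Type) [LinearOrderedCommGroupWithZero Γ₀] (v : Valuation ℂ Γ₀), v 5 < 1 →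
      v (∑ d : ZMod 5 × ZMod 5, Φ d *
        (℘[ofUpperHalfPlane UpperHalfPlane.ρ] (((d.1.val : ℂ) * UpperHalfPlane.ρ + (d.2.val : ℂ)) / 5) /
          (((2 : ℝ) ^ (2 / 3 : ℝ) * Real.Gamma (1 / 3) ^ 3 / (4 * Real.pi) : ℝ) : ℂ) ^ 2)⁻¹ ^ n) ^ 6 ≤ v 5 ^ (6 - k) := by
  intro n hn Γ₀ _ v hv
  by_cases hdvd : 3 ∣ k + 2 * n
  · by_cases hlt : n < 2 * (6 - k)
    · exact h n hn hdvd hlt Γ₀ v hv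
    · exact val_resolventSum_rho_pow_six_le_of_le (not_lt.mp hlt) Φ hΦ0 v hv
        (fun d ↦ Summit.BirchSwinnertonDyer.BirchSwinnertonDyer.Theorems.BiquadraticEisensteinDescentManinDatumSupercuspidalCMInertFormalChord.val_le_one_of_isIntegral v (hΦint d))
  · rw [resolventSum_rho_eq_zero_of_not_dvd Φ hΦrho hdvd, Valuation.map_zero, zero_pow (by norm_num)]
    exact zero_le

/-- ★ **RES₅fin ⟹ the abstract-weight core of the `j = 0` cell** (through `core_rho_of_resolventBound`): for `1 ≤ k ≤ 5` and `Φ : (ℤ/5)² → ℂ` even,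
`ρ`-equivariant (`Φ(ρ·d) = ρ^kΦ(d)`), with `Φ 0 = 0`, `Σ Φ = 0`, algebraic-integer values, the bound at the seven small pairs gives, for every `M′`
coprime to `5` and every `w` with `M′w ∈ ℤρ + ℤ`: `∃ s ∈ ℕ, 5 ∤ s, s·(Σ_d Φ(d)·E₁(w − t_d; ℤρ + ℤ))/(ϖ₁·5^{(6−k)/6}) ∈ ℤ̄`.
[cite: Rubin1999, §7.4 Prop. 7.12] [cite: Serre1979, Ch. IV §2 Prop. 7] -/
theorem core_rho_of_smallResolventBound {k : ℕ} (hk1 : 1 ≤ k) (hk5 : k ≤ 5)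
    (Φ : ZMod 5 × ZMod 5 → ℂ) (hΦ0 : Φ 0 = 0) (hΦneg : ∀ d, Φ (-d) = Φ d) (hΦsum : ∑ d, Φ d = 0)
    (hΦrho : ∀ d : ZMod 5 × ZMod 5, Φ (d.2 - d.1, -d.1) = (UpperHalfPlane.ρ : ℂ) ^ k * Φ d)
    (hΦint : ∀ d, IsIntegral ℤ (Φ d))
    (h : ∀ n : ℕ, 1 ≤ n → 3 ∣ k + 2 * n → n < 2 * (6 - k) →
      ∀ (Γ₀ : Type) [LinearOrderedCommGroupWithZero Γ₀] (v : Valuation ℂ Γ₀), v 5 < 1 →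
        v (∑ d : ZMod 5 × ZMod 5, Φ d *
          (℘[ofUpperHalfPlane UpperHalfPlane.ρ] (((d.1.val : ℂ) * UpperHalfPlane.ρ + (d.2.val : ℂ)) / 5) /
            (((2 : ℝ) ^ (2 / 3 : ℝ) * Real.Gamma (1 / 3) ^ 3 / (4 * Real.pi) : ℝ) : ℂ) ^ 2)⁻¹ ^ n) ^ 6 ≤ v 5 ^ (6 - k))
    (M' : ℕ) (hM5 : Nat.Coprime M' 5) (w : ℂ) (hMw : (M' : ℂ) * w ∈ (ofUpperHalfPlane UpperHalfPlane.ρ).lattice) :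
    ∃ s : ℕ, ¬ 5 ∣ s ∧ IsIntegral ℤ ((s : ℂ) *
      (∑ d : ZMod 5 × ZMod 5, Φ d * (ofUpperHalfPlane UpperHalfPlane.ρ).eisensteinE₁
          (w - ((d.1.val : ℂ) * UpperHalfPlane.ρ + (d.2.val : ℂ)) / 5)) /
        ((((2 : ℝ) ^ (2 / 3 : ℝ) * Real.Gamma (1 / 3) ^ 3 / (4 * Real.pi) : ℝ) : ℂ) * (5 : ℂ) ^ (((6 - k : ℕ) : ℂ) / 6))) :=
  core_rho_of_resolventBound hk1 hk5 Φ hΦ0 hΦneg hΦsum hΦint (resolventBound_rho_of_small Φ hΦ0 hΦrho hΦint h) M' hM5 w hMw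

end Summit.BirchSwinnertonDyer.BirchSwinnertonDyer.Theorems.BiquadraticEisensteinDescentManinDatumSupercuspidalCMInertResolventBoundReductionJZero

end
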